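import Literature.Topology.PlaneTopology.AnnulusLogarithm
import Literature.Topology.PlaneTopology.JordanSweepParity
import HarnessLib

/-!
# Seam transport, ST4 (4a, winding step): loops related by an upper-triangular matrix field of
# signature `(σ, +)` have winding numbers related by `σ`
(wave 4, brick (4a-wind) of sub-node ST4 `node_ST4_twistSign` of node T3c-2 `node_seam_transport` of
stub `stub_steinRealisation` = NF6, line `modp-braid-orbits` r11, crux
`ConvexBisection.AcyclicBisectionExists`, item stmt-SmoothPoincare4-10508; registered sub-goal
`helper_wind_upperTriangular`)

The twisting loop `ℓ̃` of a framed page knot transported by an angle-preserving local diffeomorphism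
`Γ` of `∂ Base g` between flat pages is, in the page frames, `ℓ̃ = M ℓ` for the matrix field
`M(t) = [[b, β], [0, b']]` — UPPER TRIANGULAR because `dΓ` maps page tangents to page tangents, with
`b' > 0` because `Γ` preserves the page angle (co-orientation) and `b = det(dΓ|T page)` of constant
sign `σ = ±1` (the page-orientation character).  This file proves the purely plane-topological
conclusion (`wind_upperTriangular`): for a non-vanishing loop `ℓ` on `[0, 1]` and continuous `b`,
`β`, `b'` with equal endpoint values, `σ b > 0`, `b' > 0`,
`wind (t ↦ (b ℓ₁ + β ℓ₂, b' ℓ₂)) = σ · wind ℓ` — the straight-line homotopy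
`((1−λ) M + λ diag(σ, 1)) ℓ` runs through invertible upper-triangular matrices (`wind_eq_of_homotopy`),
and `wind (σ ℓ₁, ℓ₂) = σ wind ℓ` (`wind_neg`, `wind_conj` for `σ = −1`).

Everything is proved; no named facts, no `sorry`, no definitions.  References: W. Fulton, *Algebraic
Topology: A First Course* (1995), §3 [Fulton1995]; J. B. Etnyre, T. Fuller, IMRN 2006, §2 [EtnyreFuller2006].
-/

noncomputable section

set_option linter.dupNamespace false

namespace Summit.SmoothPoincare4.SmoothPoincare4.Theorems.AcyclicBisectionExists.ModpBraidOrbits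

open Set Function Complex Literature.Topology.PlaneTopology
open scoped ComplexConjugate

/-- The loop `M ℓ = (b ℓ₁ + β ℓ₂, b' ℓ₂)` deformed to `(σ ℓ₁, ℓ₂)`: stage `λ` of the straight-line
homotopy of matrix fields `(1−λ) M + λ diag(σ, 1)` applied to `ℓ`. [folklore] -/
theorem upperTriangular_homotopy_ne_zero {ℓ : ℝ → ℂ} {b β b' : ℝ → ℝ} {σ : ℤ} (hσ : σ = 1 ∨ σ = -1)
    {t : ℝ} (hbs : 0 < σ * b t) (hb' : 0 < b' t) (hℓ : ℓ t ≠ 0) {lam : ℝ} (hlam : lam ∈ Icc (0 : ℝ) 1) :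
    (⟨((1 - lam) * b t + lam * σ) * (ℓ t).re + (1 - lam) * β t * (ℓ t).im,
      ((1 - lam) * b' t + lam) * (ℓ t).im⟩ : ℂ) ≠ 0 := by
  intro h0
  have h2 : ((1 - lam) * b' t + lam) * (ℓ t).im = 0 := by
    have := congrArg Complex.im h0; simpa using this
  have h1 : ((1 - lam) * b t + lam * σ) * (ℓ t).re + (1 - lam) * β t * (ℓ t).im = 0 := by
    have := congrArg Complex.re h0; simpa using this
  have hc2 : 0 < (1 - lam) * b' t + lam := by
    rcases eq_or_lt_of_le hlam.2 with h | h
    · rw [h]; norm_num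
    · nlinarith [hlam.1, hb']
  have him : (ℓ t).im = 0 := by
    rcases mul_eq_zero.1 h2 with h | h
    · exact absurd h hc2.ne'
    · exact h
  rw [him, mul_zero, add_zero] at h1
  have hc1 : 0 < (σ : ℝ) * ((1 - lam) * b t + lam * σ) := by
    have hσ2 : (σ : ℝ) * σ = 1 := by rcases hσ with h | h <;> simp [h]
    have e : (σ : ℝ) * ((1 - lam) * b t + lam * σ) = (1 - lam) * (σ * b t) + lam := by
      linear_combination lam * hσ2
    rw [e]
    rcases eq_or_lt_of_le hlam.2 with h | h
    · rw [h]; norm_num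
    · nlinarith [hlam.1, hbs]
  have hre : (ℓ t).re = 0 := by
    rcases mul_eq_zero.1 h1 with h | h
    · exfalso; rw [h, mul_zero] at hc1; exact lt_irrefl _ hc1
    · exact h
  exact hℓ (Complex.ext hre him)

/-- **Winding numbers of loops related by an upper-triangular matrix field of signature `(σ, +)`**:
`wind (b ℓ₁ + β ℓ₂, b' ℓ₂) = σ · wind ℓ` for `σ b > 0`, `b' > 0`. [cite: Fulton1995, §3] -/
theorem wind_upperTriangular {ℓ : ℝ → ℂ} (hℓ : IsNonvanishingLoop ℓ) {b β b' : ℝ → ℝ}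
    (hb : ContinuousOn b (Icc 0 1)) (hβ : ContinuousOn β (Icc 0 1)) (hb' : ContinuousOn b' (Icc 0 1))
    (hb01 : b 0 = b 1) (hβ01 : β 0 = β 1) (hb'01 : b' 0 = b' 1) {σ : ℤ} (hσ : σ = 1 ∨ σ = -1)
    (hbs : ∀ t ∈ Icc (0 : ℝ) 1, 0 < σ * b t) (hb'pos : ∀ t ∈ Icc (0 : ℝ) 1, 0 < b' t) :
    wind (fun t => (⟨b t * (ℓ t).re + β t * (ℓ t).im, b' t * (ℓ t).im⟩ : ℂ)) = σ * wind ℓ := by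
  -- the straight-line homotopy of matrix fields
  let H : ℝ → ℝ → ℂ := fun lam t =>
    ⟨((1 - lam) * b t + lam * σ) * (ℓ t).re + (1 - lam) * β t * (ℓ t).im,
      ((1 - lam) * b' t + lam) * (ℓ t).im⟩
  have hHc : ContinuousOn (uncurry H) (Icc 0 1 ×ˢ Icc 0 1) := by
    have hℓc : ContinuousOn (fun p : ℝ × ℝ => ℓ p.2) (Icc 0 1 ×ˢ Icc 0 1) :=
      hℓ.continuousOn.comp continuous_snd.continuousOn fun p hp => hp.2
    have hbc : ContinuousOn (fun p : ℝ × ℝ => b p.2) (Icc 0 1 ×ˢ Icc 0 1) :=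
      hb.comp continuous_snd.continuousOn fun p hp => hp.2
    have hβc : ContinuousOn (fun p : ℝ × ℝ => β p.2) (Icc 0 1 ×ˢ Icc 0 1) :=
      hβ.comp continuous_snd.continuousOn fun p hp => hp.2
    have hb'c : ContinuousOn (fun p : ℝ × ℝ => b' p.2) (Icc 0 1 ×ˢ Icc 0 1) :=
      hb'.comp continuous_snd.continuousOn fun p hp => hp.2
    have hre : ContinuousOn (fun p : ℝ × ℝ => (ℓ p.2).re) (Icc 0 1 ×ˢ Icc 0 1) :=
      Complex.continuous_re.comp_continuousOn hℓc
    have him : ContinuousOn (fun p : ℝ × ℝ => (ℓ p.2).im) (Icc 0 1 ×ˢ Icc 0 1) :=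
      Complex.continuous_im.comp_continuousOn hℓc
    have h1 : ContinuousOn (fun p : ℝ × ℝ =>
        ((1 - p.1) * b p.2 + p.1 * σ) * (ℓ p.2).re + (1 - p.1) * β p.2 * (ℓ p.2).im) (Icc 0 1 ×ˢ Icc 0 1) :=
      ((((continuous_const.sub continuous_fst).continuousOn.mul hbc).add
        (continuous_fst.continuousOn.mul continuousOn_const)).mul hre).add
        (((continuous_const.sub continuous_fst).continuousOn.mul hβc).mul him)
    have h2 : ContinuousOn (fun p : ℝ × ℝ => ((1 - p.1) * b' p.2 + p.1) * (ℓ p.2).im) (Icc 0 1 ×ˢ Icc 0 1) :=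
      (((continuous_const.sub continuous_fst).continuousOn.mul hb'c).add continuous_fst.continuousOn).mul him
    have h3 := Complex.equivRealProdCLM.symm.continuous.comp_continuousOn (h1.prodMk h2)
    exact h3
  have hloop : ∀ s ∈ Icc (0 : ℝ) 1, H s 0 = H s 1 := fun s _ => by
    simp only [H, hb01, hβ01, hb'01, hℓ.eq_endpoints]
  have hne : ∀ s ∈ Icc (0 : ℝ) 1, ∀ t ∈ Icc (0 : ℝ) 1, H s t ≠ 0 := fun s hs t ht =>
    upperTriangular_homotopy_ne_zero hσ (hbs t ht) (hb'pos t ht) (hℓ.ne_zero t ht) hs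
  have hwind := wind_eq_of_homotopy hHc hloop hne
  have e0 : H 0 = fun t => (⟨b t * (ℓ t).re + β t * (ℓ t).im, b' t * (ℓ t).im⟩ : ℂ) := by
    funext t; simp [H]
  rw [e0] at hwind
  rw [hwind]
  -- the end loop `(σ ℓ₁, ℓ₂)`
  rcases hσ with h | h
  · subst h
    have e1 : H 1 = ℓ := by
      funext t; apply Complex.ext <;> simp [H]
    rw [e1]; simp
  · subst h
    have e1 : H 1 = fun t => -conj (ℓ t) := by
      funext t; apply Complex.ext <;> simp [H]
    have hconj : IsNonvanishingLoop fun t => conj (ℓ t) :=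
      ⟨Complex.continuous_conj.comp_continuousOn hℓ.continuousOn,
        fun t ht => (map_ne_zero _).2 (hℓ.ne_zero t ht), by rw [hℓ.eq_endpoints]⟩
    rw [e1, wind_neg hconj, wind_conj hℓ]
    simp

/-- **Sub-goal `helper_wind_upperTriangular` of stub `stub_steinRealisation`** (NF6 ▸ T3 ▸ T3c-2 ▸ ST4
`node_ST4_twistSign`, brick (4a-wind); wave 4, lead c5): for a non-vanishing loop `ℓ` on `[0, 1]` and
continuous coefficients `b, β, b'` with equal endpoint values, `σ = ±1`, `σ b > 0`, `b' > 0`, the loop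
`t ↦ (b ℓ₁ + β ℓ₂, b' ℓ₂)` (an upper-triangular matrix field of signature `(σ, +)` applied to `ℓ`) has
winding number `σ · wind ℓ` — the homotopy step of the twisting-sign computation for angle-preserving
page maps. [cite: Fulton1995, §3] -/
theorem helper_wind_upperTriangular : ∀ (ℓ : ℝ → ℂ) (b β b' : ℝ → ℝ) (σ : ℤ), Literature.Topology.PlaneTopology.IsNonvanishingLoop ℓ → ContinuousOn b (Set.Icc 0 1) → ContinuousOn β (Set.Icc 0 1) → ContinuousOn b' (Set.Icc 0 1) → b 0 = b 1 → β 0 = β 1 → b' 0 = b' 1 → (σ = 1 ∨ σ = -1) → (∀ t ∈ Set.Icc (0 : ℝ) 1, 0 < (σ : ℝ) * b t) → (∀ t ∈ Set.Icc (0 : ℝ) 1, 0 < b' t) → Literature.Topology.PlaneTopology.wind (fun t => (⟨b t * (ℓ t).re + β t * (ℓ t).im, b' t * (ℓ t).im⟩ : ℂ)) = σ * Literature.Topology.PlaneTopology.wind ℓ :=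
  fun _ _ _ _ _ hℓ hb hβ hb' hb01 hβ01 hb'01 hσ hbs hb'pos =>
    wind_upperTriangular hℓ hb hβ hb' hb01 hβ01 hb'01 hσ hbs hb'pos

end Summit.SmoothPoincare4.SmoothPoincare4.Theorems.AcyclicBisectionExists.ModpBraidOrbits

end
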